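import Summits.BirchSwinnertonDyer.BirchSwinnertonDyer.Theorems.EisensteinPrimesInertiaTorsionFiniteGeneric
import Summits.BirchSwinnertonDyer.Rank1Residual.X2.NonPrimitiveQuotientCorank
import Literature.NumberTheory.EllipticCurves.GreenbergSelmerDualDataExistsProofs
import Literature.NumberTheory.EllipticCurves.Castella2018.AnticyclotomicSelmer
import HarnessLib

/-!
# `corank_{ℤ_p}(Sel_𝔭^{S₀}(K_∞, M)/Sel_𝔭(K_∞, M)) ≤ Σ_{v∈S₀} N_v · c_v` for CASTELLA's anticyclotomic
# Selmer groups (local TRIVIALITY away from `p`), generic module — the `f`-side twin of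
# `UnrSelmerQuotientCorankLeGeneric.zpCorank_quotient_le_sum`

Cell `bsd-eis` (home `run/shared/lean/pub/bsd-eis/`), seat `bsd-line-x1-p1-w2` (D-0154 width seat on
crux 2 `GoodLatticeBDPValue` = stmt-BirchSwinnertonDyer-19032, line `halves` v14, stub
`stub_imprimCorank`, `f`-SIDE conjunct `KellerYin2024.rem142_goodLattice_selmerAc_imprimitive`:
`zpCorank (Sel_v̄^{Sf}/Sel_v̄^∅) = Σ_{w∈Sf} curveLocalLambda κ (W/K) w` for Castella's
`AcSelmer.selmerAc`), first file of its unconditional `≤`-half. Castella's `Sel_𝔭^Σ(K_∞, M) =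
AcSelmer.selmerOver H M p 𝔭 Σ` (Cas18 Def. 2.2 in the `K_∞`-formulation) imposes at a finite `v ∤ p`,
`v ∉ Σ` the LOCAL TRIVIALITY of every conjugate at the chosen place above `v` (`GreenbergSelmer.awayKer`,
restriction to `H ⊓ D_v`), where the Greenberg–Vatsal groups of the character side impose
UNRAMIFIEDNESS (`GreenbergVatsal2000.unramifiedKer`, restriction to `H ⊓ I_v`). This file proves the
same embedding-and-count bound as p606873 for Castella's groups, reading the quotient through the
INERTIA restrictions (so that the sharp place count p607080 and every inertia-level local bound plug
in unchanged), at the price of ONE displayed hypothesis per place,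
  `hUT : unramifiedKer H M v ≤ awayKer H M v`   ("unramified ⇒ locally trivial above `v` over `K_∞`"),
true at every `v ∤ p` finitely decomposed in `K_∞` (`Gal(K̄_v/K_{∞,η}) / I_v` is pro-prime-to-`p`;
kernel bricks `…ProPrimeToPCocycleVanishing` p547081, `…LocallyTrivialConjIndex`), to be discharged
by the consumer — not restated here.

* §1 `awayKer_le_unramifiedKer` — local triviality implies unramifiedness (restriction
  `H ⊓ D_v → H ⊓ I_v` factors `r_v`), any `H`, `M`, `v`.
* §2 **`zpCorank_selmerOver_quotient_le_sum`** — for a GENERIC discrete `Γ_K`-module `M` (`p`-primary,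
  open stabilisers, `p`-divisible, `M[p]` finite of `p`-power order), `H = ker κ`, any `𝔭`, a finite
  `S₀` of places `v ∤ p` with `hrep` (`Γ_K = H · D_v · {γⁿ : n < N_v}`), `hloc` (subgroups of the image
  of `r_v : H¹(H, M) → H¹(H ∩ I_v, M)` have `zpCorank ≤ c_v`) and `hUT`:
  `zpCorank (Sel_𝔭^{S₀}/Sel_𝔭^∅) p ≤ Σ_{v∈S₀} N_v · c_v`. For `M = E[p^∞]` this is literally
  `AcSelmer.selmerAc W p κ 𝔭` (`rfl`).

HONEST FRAMING: tool theorems only (no definition, no named fact, no `sorry`); closes nothing by itself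
(`--supports stmt-BirchSwinnertonDyer-19032`); BSD / Mazur's main conjecture is proved for no curve.

References: Castella, Camb. J. Math. 6 (2018) Def. 2.2; Castella–Grossi–Lee–Skinner 2022 §2.3, proof of
Thm. 1.5.1 (L909–931); Greenberg–Vatsal 2000 §2 pp. 16–17, 20–22; Greenberg 1989 §1 p. 98 ("one could
replace `I_v` by `D_v`"); Keller–Yin arXiv:2402.12781v2 Rem. 1.4.2.
-/

-- `Summit.BirchSwinnertonDyer.BirchSwinnertonDyer.…`: summit and sub-problem share a name (D-0017 layout).
set_option linter.dupNamespace false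
set_option autoImplicit false

noncomputable section

open scoped Classical AddSubgroup

open NumberField IsDedekindDomain Field CategoryTheory
open Literature.NumberTheory.GaloisRepresentations Literature.NumberTheory.EllipticCurves
  Literature.NumberTheory.EllipticCurves.GreenbergSelmer
  Literature.NumberTheory.EllipticCurves.GreenbergVatsal2000
  Literature.NumberTheory.EllipticCurves.Castella2018
  Summit.BirchSwinnertonDyer.Rank1Residual.Iwasawa
  Summit.BirchSwinnertonDyer.Rank1Residual.X2.NonPrimitiveQuotientCorank
  Summit.BirchSwinnertonDyer.BirchSwinnertonDyer.Theorems.InertiaTorsionFiniteGeneric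

universe u

namespace Summit.BirchSwinnertonDyer.BirchSwinnertonDyer.Theorems.SelmerAcQuotientCorankLeGeneric

/-! ## §1 Local triviality implies unramifiedness -/

section Away

variable {K : Type u} [Field K] [NumberField K] (H : Subgroup (absoluteGaloisGroup K))
  (M : Type u) [AddCommGroup M] [DistribMulAction (absoluteGaloisGroup K) M] [TopologicalSpace M]
  [DiscreteTopology M] (v : HeightOneSpectrum (𝓞 K))

/-- **`awayKer ≤ unramifiedKer`**: a class of `H¹(H, M)` that dies on `H ⊓ D_v` (Castella's local
triviality at the chosen place above `v`) dies on `H ⊓ I_v` (Greenberg–Vatsal's unramified condition):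
the restriction to `H ⊓ I_v` factors through the restriction to `H ⊓ D_v` (`resH1Hom_comp`).
Greenberg 1989 p. 98: "one could replace `I_v` by `D_v`". [cite: Greenberg1989, §1 p. 98]
[cite: GreenbergVatsal2000, §2 p. 17] -/
theorem awayKer_le_unramifiedKer : awayKer H M v ≤ unramifiedKer H M v := by
  intro c hc
  -- the inclusion `inertiaIn H v → H ⊓ D_v`
  let ι : inertiaIn H v →ₜ* ↥(H ⊓ decomp (K := K) v) :=
    { toFun := fun x ↦ ⟨((x : decomp (K := K) v) : absoluteGaloisGroup K),
        Subgroup.mem_inf.2 ⟨((mem_inertiaIn_iff H v _).1 x.2).1, (x : decomp (K := K) v).2⟩⟩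
      map_one' := rfl
      map_mul' := fun _ _ ↦ rfl
      continuous_toFun := (continuous_subtype_val.comp continuous_subtype_val).subtype_mk _ }
  have hfac : resH1Hom (inertiaInToH H v) (AddMonoidHom.id M) (fun _ _ ↦ rfl) =
      (resH1Hom ι (AddMonoidHom.id M) (fun _ _ ↦ rfl)).comp
        (resOfLe M (inf_le_left : H ⊓ decomp (K := K) v ≤ H)) := by
    rw [resOfLe, resH1Hom_comp]
    exact resH1Hom_congr (by ext; rfl) (by ext; rfl) _ _
  change c ∈ (resH1Hom (inertiaInToH H v) (AddMonoidHom.id M) fun _ _ ↦ rfl).ker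
  rw [AddMonoidHom.mem_ker, hfac, AddMonoidHom.comp_apply]
  have hc' : resOfLe M (inf_le_left : H ⊓ decomp (K := K) v ≤ H) c = 0 := hc
  rw [hc', map_zero]

end Away

/-! ## §2 The quotient corank bound for Castella's `Sel_𝔭^{S₀}/Sel_𝔭^∅` -/

section Quotient

variable {K : Type u} [Field K] [NumberField K] {M : Type u} [AddCommGroup M]
  [DistribMulAction (absoluteGaloisGroup K) M] [TopologicalSpace M] [DiscreteTopology M]
  {p : ℕ} [Fact p.Prime] (κ : ZpExtension K p) {γ : absoluteGaloisGroup K}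

omit [Fact p.Prime] in
/-- `Sel_𝔭^∅ = Sel_𝔭^{S₀} ∩` (locally trivial above `S₀`): a class lies in `Sel_𝔭(L, M)` iff it lies in
`Sel_𝔭^{S₀}(L, M)` and for every `v ∈ S₀` with `v ∤ p` all its conjugates die on `H ⊓ D_v`
(bookkeeping on `AcSelmer.mem_selmerOver_iff`). [cite: Castella2018, Def. 2.2 (arXiv:1704.06608 p. 5)] -/
theorem mem_selmerOver_empty_iff (H : Subgroup (absoluteGaloisGroup K)) [H.Normal]
    (𝔭 : HeightOneSpectrum (𝓞 K)) (S₀ : Set (HeightOneSpectrum (𝓞 K))) (c : subgroupH1 H M) :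
    c ∈ AcSelmer.selmerOver H M p 𝔭 (∅ : Set (HeightOneSpectrum (𝓞 K))) ↔
      c ∈ AcSelmer.selmerOver H M p 𝔭 S₀ ∧
        ∀ v ∈ S₀, ((p : ℕ) : 𝓞 K) ∉ v.asIdeal → ∀ σ : absoluteGaloisGroup K,
          conjH1 H M σ c ∈ awayKer H M v := by
  rw [AcSelmer.mem_selmerOver_iff, AcSelmer.mem_selmerOver_iff]
  constructor
  · rintro ⟨haway, hinf, hstr⟩
    exact ⟨⟨fun v hv _ σ ↦ haway v hv (Set.notMem_empty v) σ, hinf, hstr⟩,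
      fun v _ hpv σ ↦ haway v hpv (Set.notMem_empty v) σ⟩
  · rintro ⟨⟨haway, hinf, hstr⟩, hS⟩
    refine ⟨fun v hpv _ σ ↦ ?_, hinf, hstr⟩
    by_cases hv : v ∈ S₀
    · exact hS v hv hpv σ
    · exact haway v hpv hv σ

/-- **`zpCorank (Sel_𝔭^{S₀}(K_∞, M)/Sel_𝔭(K_∞, M)) p ≤ Σ_{v∈S₀} N_v · c_v` for CASTELLA's groups**
(`AcSelmer.selmerOver (ker κ) M p 𝔭 ·`; generic discrete `Γ_K`-module `M`: `p`-primary `htor`, `M[p]`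
finite of `p`-power order `hcard`, `p`-divisible `hdiv`, open stabilisers `hstab`; any `𝔭`; a finite
set `S₀` of places `v ∤ p`), granted at each `v ∈ S₀`: the representative property
`Γ_K = H · D_v · {γⁿ : n < N_v}` (`hrep`), a bound `c_v` on the corank formula of every subgroup of the
image of the INERTIA restriction `r_v : H¹(H, M) → H¹(H ∩ I_v, M)` (`hloc`), and "unramified ⇒
locally trivial above `v`" (`hUT : unramifiedKer ≤ awayKer`, true at finitely decomposed `v ∤ p` by the
pro-prime-to-`p` quotient `D/I` over `K_∞`; supplied by the consumer). Proof: the detecting map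
`Φ = (r_v ∘ conj_{γⁿ})_{v, n<N_v}` has kernel `Sel_𝔭^∅` on `Sel_𝔭^{S₀}` (`hUT` one way,
`awayKer_le_unramifiedKer` the other, `forall_conjH1_mem_unramifiedKer_of_forall_lt` for the finitely
many conjugates), so `Sel^{S₀}/Sel^∅ ≅ Φ(Sel^{S₀}) ↪ ∏_v ∏_{n<N_v} Y_{v,n}` with `Y_{v,n} ⊆ r_v(H¹(H, M))`
`p`-primary with finite `p`-torsion (p573188); `zpCorank` is monotone under injections and additive
over finite products (b2b X2 §1). The `f`-side twin of p606873 (CGLS proof of Thm. 1.5.1: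
"`0 → H¹_{𝓕_Gr}(K,M_E) → H¹_{𝓕_Gr^S}(K,M_E) → ∏_{w∈S} H¹(K_w,M_E)`", UPPER bound on the corank of
the cokernel of the first map). [cite: CastellaGrossiLeeSkinner2022, proof of Thm. 1.5.1 (arXiv:2008.02571v2 TeX L909–931)]
[cite: Castella2018, Def. 2.2 (arXiv:1704.06608 p. 5)] [cite: GreenbergVatsal2000, §2 pp. 17, 20–22] -/
theorem zpCorank_selmerOver_quotient_le_sum [Finite ↥(M[(p : ℤ)])]
    (htor : ∀ m : M, ∃ k : ℕ, p ^ k • m = 0)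
    (hcard : ∃ k : ℕ, Nat.card ↥(M[(p : ℤ)]) = p ^ k)
    (hdiv : ∀ m : M, ∃ m' : M, p • m' = m)
    (hstab : ∀ m : M,
      IsOpen (MulAction.stabilizer (absoluteGaloisGroup K) m : Set (absoluteGaloisGroup K)))
    (𝔭 : HeightOneSpectrum (𝓞 K))
    (S₀ : Finset (HeightOneSpectrum (𝓞 K))) (hS₀ : ∀ v ∈ S₀, ((p : ℕ) : 𝓞 K) ∉ v.asIdeal)
    (N c : HeightOneSpectrum (𝓞 K) → ℕ)
    (hrep : ∀ v ∈ S₀, ∀ σ : absoluteGaloisGroup K, ∃ n < N v, ∃ δ ∈ decomp (K := K) v,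
      ∃ h ∈ κ.kerSubgroup, σ = h * (δ * γ ^ n))
    (hloc : ∀ v ∈ S₀, ∀ Y : AddSubgroup (discreteH1 (inertiaIn κ.kerSubgroup v) M),
      (∀ y ∈ Y, ∃ x : subgroupH1 κ.kerSubgroup M,
        resH1Hom (inertiaInToH κ.kerSubgroup v) (AddMonoidHom.id M) (fun _ _ ↦ rfl) x = y) →
      zpCorank Y p ≤ c v)
    (hUT : ∀ v ∈ S₀, unramifiedKer κ.kerSubgroup M v ≤ awayKer κ.kerSubgroup M v) :
    zpCorank (↥(AcSelmer.selmerOver κ.kerSubgroup M p 𝔭 (↑S₀ : Set (HeightOneSpectrum (𝓞 K)))) ⧸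
      (AcSelmer.selmerOver κ.kerSubgroup M p 𝔭 (∅ : Set (HeightOneSpectrum (𝓞 K)))).addSubgroupOf
        (AcSelmer.selmerOver κ.kerSubgroup M p 𝔭 (↑S₀ : Set (HeightOneSpectrum (𝓞 K))))) p ≤
      ∑ v ∈ S₀, N v * c v := by
  haveI : κ.kerSubgroup.Normal := by rw [ZpExtension.kerSubgroup]; infer_instance
  set H := κ.kerSubgroup with hH
  set SS := AcSelmer.selmerOver H M p 𝔭 (↑S₀ : Set (HeightOneSpectrum (𝓞 K))) with hSS
  set S := AcSelmer.selmerOver H M p 𝔭 (∅ : Set (HeightOneSpectrum (𝓞 K))) with hS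
  let ι := ↥S₀
  -- the detecting map
  let Φ : subgroupH1 H M →+ (Π i : ι, Fin (N i.1) → discreteH1 (inertiaIn H i.1) M) :=
    AddMonoidHom.pi fun i ↦ AddMonoidHom.pi fun n ↦
      (resH1Hom (inertiaInToH H i.1) (AddMonoidHom.id M) fun _ _ ↦ rfl).comp
        (conjH1 H M (γ ^ (n : ℕ)))
  have hΦ : ∀ (x : subgroupH1 H M) (i : ι) (n : Fin (N i.1)),
      Φ x i n = resH1Hom (inertiaInToH H i.1) (AddMonoidHom.id M) (fun _ _ ↦ rfl)
        (conjH1 H M (γ ^ (n : ℕ)) x) := fun _ _ _ ↦ rfl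
  let φ : SS →+ (Π i : ι, Fin (N i.1) → discreteH1 (inertiaIn H i.1) M) := Φ.comp SS.subtype
  -- (a) the kernel of `φ` is `S`
  have hker : ∀ s : SS, φ s = 0 ↔ (s : subgroupH1 H M) ∈ S := by
    intro s
    constructor
    · intro h0
      rw [hS, mem_selmerOver_empty_iff H 𝔭 (↑S₀ : Set _)]
      refine ⟨s.2, fun v hv hpv σ ↦ hUT v (Finset.mem_coe.1 hv) ?_⟩
      refine forall_conjH1_mem_unramifiedKer_of_forall_lt κ M
        (hrep v (Finset.mem_coe.1 hv)) (fun n hn ↦ ?_) σ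
      have h := congrFun (congrFun h0 ⟨v, Finset.mem_coe.1 hv⟩) ⟨n, hn⟩
      rw [show φ s ⟨v, Finset.mem_coe.1 hv⟩ ⟨n, hn⟩ = Φ (s : subgroupH1 H M) ⟨v, _⟩ ⟨n, hn⟩
        from rfl, hΦ] at h
      exact h
    · intro hs
      funext i n
      rw [show φ s i n = Φ (s : subgroupH1 H M) i n from rfl, hΦ]
      exact awayKer_le_unramifiedKer H M i.1
        (((mem_selmerOver_empty_iff H 𝔭 (↑S₀ : Set _) _).1 hs).2 i.1 (Finset.mem_coe.2 i.2)
          (hS₀ i.1 i.2) (γ ^ (n : ℕ)))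
  have hkerEq : φ.ker = S.addSubgroupOf SS := by
    ext s
    rw [AddMonoidHom.mem_ker, AddSubgroup.mem_addSubgroupOf]
    exact hker s
  -- (b) `SS/S ≅ range φ`
  have hcongr : zpCorank (↥SS ⧸ S.addSubgroupOf SS) p = zpCorank φ.range p := by
    refine zpCorank_congr ?_ p
    exact (QuotientAddGroup.quotientAddEquivOfEq hkerEq).symm.trans
      (QuotientAddGroup.quotientKerEquivRange φ)
  rw [hcongr]
  -- (c) the images `Y_{v,n}` and the product `B`
  let Yv : ∀ i : ι, Fin (N i.1) → AddSubgroup (discreteH1 (inertiaIn H i.1) M) := fun i n ↦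
    (((resH1Hom (inertiaInToH H i.1) (AddMonoidHom.id M) fun _ _ ↦ rfl).comp
      (conjH1 H M (γ ^ (n : ℕ)))).comp SS.subtype).range
  have hYprim : ∀ (i : ι) (n : Fin (N i.1)) (y : Yv i n), ∃ k : ℕ, p ^ k • y = 0 := by
    rintro i n ⟨_, ⟨s, rfl⟩⟩
    obtain ⟨k, hk⟩ := GreenbergSelmer.exists_pow_smul_subgroupH1_eq_zero κ M htor
      (s : subgroupH1 H M)
    refine ⟨k, Subtype.ext ?_⟩
    change p ^ k • ((resH1Hom (inertiaInToH H i.1) (AddMonoidHom.id M) fun _ _ ↦ rfl)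
      (conjH1 H M (γ ^ (n : ℕ)) (s : subgroupH1 H M))) = 0
    rw [← map_nsmul, ← map_nsmul, hk, map_zero, map_zero]
  have hYfin : ∀ (i : ι) (n : Fin (N i.1)), Finite ((↥(Yv i n))[(p : ℤ)]) := by
    intro i n
    have hfin := finite_setOf_nsmul_eq_zero_discreteH1_inertiaIn κ i.1 hcard hdiv hstab
      (hS₀ i.1 i.2)
    haveI := hfin.to_subtype
    refine Finite.of_injective (fun y : (↥(Yv i n))[(p : ℤ)] ↦
      (⟨((y : Yv i n) : discreteH1 (inertiaIn H i.1) M), ?_⟩ :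
        {x : discreteH1 (inertiaIn H i.1) M | p • x = 0})) ?_
    · have h := AddSubgroup.torsionBy.nsmul_iff.1 y.2
      change p • ((y : Yv i n) : discreteH1 (inertiaIn H i.1) M) = 0
      rw [← AddSubmonoidClass.coe_nsmul, h, ZeroMemClass.coe_zero]
    · intro y z hyz
      have h := congrArg Subtype.val hyz
      exact Subtype.ext (Subtype.ext h)
  -- inner and outer products
  have hinner : ∀ i : ι, zpCorank (∀ n : Fin (N i.1), Yv i n) p ≤ N i.1 * c i.1 := by
    intro i
    haveI : ∀ n : Fin (N i.1), Finite ((↥(Yv i n))[(p : ℤ)]) := hYfin i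
    rw [zpCorank_pi (hYprim i)]
    calc ∑ n : Fin (N i.1), zpCorank (Yv i n) p ≤ ∑ _n : Fin (N i.1), c i.1 :=
          Finset.sum_le_sum fun n _ ↦ hloc i.1 i.2 (Yv i n) (by
            rintro _ ⟨s, rfl⟩
            exact ⟨conjH1 H M (γ ^ (n : ℕ)) (s : subgroupH1 H M), rfl⟩)
      _ = N i.1 * c i.1 := by rw [Finset.sum_const, Finset.card_univ, Fintype.card_fin, smul_eq_mul]
  have hBprim : ∀ b : (∀ i : ι, ∀ n : Fin (N i.1), Yv i n), ∃ k : ℕ, p ^ k • b = 0 :=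
    primary_pi fun i ↦ primary_pi (hYprim i)
  haveI hBfin : Finite ((∀ i : ι, ∀ n : Fin (N i.1), Yv i n)[(p : ℤ)]) := by
    haveI : ∀ i : ι, Finite ((∀ n : Fin (N i.1), Yv i n)[(p : ℤ)]) := fun i ↦ by
      haveI : ∀ n : Fin (N i.1), Finite ((↥(Yv i n))[(p : ℤ)]) := hYfin i
      exact finite_torsionBy_pi
    exact finite_torsionBy_pi
  -- (d) `range φ ↪ B`
  let j : φ.range →+ (∀ i : ι, ∀ n : Fin (N i.1), Yv i n) :=
    { toFun := fun y ↦ fun i n ↦ ⟨(y : ∀ i : ι, Fin (N i.1) → discreteH1 (inertiaIn H i.1) M) i n, by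
        obtain ⟨s, hs⟩ := y.2
        exact ⟨s, congrFun (congrFun hs i) n⟩⟩
      map_zero' := by funext i n; rfl
      map_add' := fun y z ↦ by funext i n; rfl }
  have hj : Function.Injective j := by
    intro y z hyz
    apply Subtype.ext
    funext i n
    have h := congrArg (fun f : (∀ i : ι, ∀ n : Fin (N i.1), Yv i n) ↦
      ((f i n : Yv i n) : discreteH1 (inertiaIn H i.1) M)) hyz
    exact h
  calc zpCorank φ.range p ≤ zpCorank (∀ i : ι, ∀ n : Fin (N i.1), Yv i n) p :=
        zpCorank_le_of_injective j hj hBprim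
    _ = ∑ i : ι, zpCorank (∀ n : Fin (N i.1), Yv i n) p := by
        haveI : ∀ i : ι, Finite ((∀ n : Fin (N i.1), Yv i n)[(p : ℤ)]) := fun i ↦ by
          haveI : ∀ n : Fin (N i.1), Finite ((↥(Yv i n))[(p : ℤ)]) := hYfin i
          exact finite_torsionBy_pi
        exact zpCorank_pi fun i ↦ primary_pi (hYprim i)
    _ ≤ ∑ i : ι, N i.1 * c i.1 := Finset.sum_le_sum fun i _ ↦ hinner i
    _ = ∑ v ∈ S₀, N v * c v := Finset.sum_coe_sort S₀ (fun v ↦ N v * c v)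

end Quotient

end Summit.BirchSwinnertonDyer.BirchSwinnertonDyer.Theorems.SelmerAcQuotientCorankLeGeneric

end
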